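import Literature.NumberTheory.GaloisCohomology.Howard2004.KolyvaginSystemRescalingLevelwiseProofs
import Literature.NumberTheory.GaloisCohomology.Howard2004.FiniteSingularSlotUnitsLevelwiseProofs
import Literature.NumberTheory.GaloisCohomology.Howard2004.TransverseScalarStableProofs
import Literature.NumberTheory.GaloisCohomology.Howard2004.DVRLevelSelmerFiniteProofs
import HarnessLib

/-!
# Howard 2004, Thm. 1.6.1 «WLOG tame»: Theorem 1.6.1 for TAME-PINNED `DVRSetting`s implies Theorem 1.6.1 as typed
# (`thm161_dvrKolyvaginBound`, every admissible finite–singular slot) — theorems only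

Topic `NumberTheory/GaloisCohomology/Howard2004` (sequel to `FiniteSingularSlotUnitsLevelwiseProofs` (levelwise units
relating an admissible slot family to the tame slots + their compatibility), `KolyvaginSystemRescalingLevelwiseProofs`
(transport of Kolyvagin systems along levelwise unit rescalings), `TransverseScalarStableProofs` (the hypotheses
`IsSelmerScalarStable` / `FsScalarNaturalAt` discharged under H), `FiniteSingularTameTower` (`withTameSlotOn`,
`fs_admissible_of_fs_eq_tameSlotOn_levels`, `fs_natural_of_fs_eq_tameSlotOn`) and `KolyvaginSystemRescalingProofs`
(`conclusion_with_fs_iff`)).  THEOREMS ONLY: no definition, no named fact, no instance, no notation, no `sorry`.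

WHY (INPUTS row G87 = `Howard2004.thm161_dvrKolyvaginBound` = Howard Thm. 1.6.1; stub `stub_h161` of the μ-crux
stmt-BirchSwinnertonDyer-22642, binder `h161` of crux 23055's print-leaf census; cell `pub/bsd-print-x9`, seat
`bsd-line-x10b-p1-w7` g8, brick (TAME-WLOG) named free by bsd-line-x10b-p1 LEAD g12 (O3)).  The named fact
`thm161_dvrKolyvaginBound` quantifies over EVERY `DVRSetting` with H.0–H.5, in particular over every ADMISSIBLE
finite–singular slot family (`SatisfiesH.fs_admissible`: Def. 1.1.8's comparison isomorphisms up to the print-derivable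
ambiguity, reading note (v) of `FiniteSingularNatural`), whereas the π-adic refinement programme (`DVRSetting.refine`,
seat `bsd-line-x10b-p1-w2`) proves it for settings whose slots ARE the guarded tame slots (`htame`).  Reading note (v):
«`fs n λ = u_ℓ(n) · φ^{fs}_ℓ` with `u_ℓ(n) ∈ R'ˣ` … then `κ ↦ κ″`, `κ″_n := (∏ u_ℓ(n)) κ_n`, is a bijection
`KS(T,F,𝓛; fs) → KS(T,F,𝓛; φ^{fs})` with `κ″_1 = κ_1`, and the conclusion of Thm. 1.6.1 mentions only `κ_1`.  So
Thm. 1.6.1 for THE map `φ^{fs}` implies it for every admissible slot.»  This file is that sentence in the kernel: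

* **`DVRSetting.satisfiesH_withTameSlotOn`** — H.0–H.5 for «`S` with the tame slots» (`{ S with LD k :=
  (S.LD k).withTameSlotOn pins (fun n v ↦ n ∈ levels S.L ∧ v ∈ n) _ }`): all clauses verbatim from `hy`, the three slot
  clauses from the tree's tame-slot lemmas;
* **`DVRSetting.thm161_of_forall_tame`** — `(∀ … (S) (κ) (hy) (pins) (hP), (∀ k, (S.LD k).fs = tameSlotOn pins
  (S.LD k).ρq (fun n v ↦ n ∈ levels S.L ∧ v ∈ n) (hP k)) → S.LargePrimes → κ.one ≠ 0 → S.Conclusion hy κ.one) →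
  thm161_dvrKolyvaginBound`: the units are chosen per level (`exists_levelwise_units` — no stationarity, no
  completeness of `R`), `κ` is transported to the tame slots with the same `κ_1`
  (`exists_kolyvaginSystem_smul_of_isRescaledFs_levelwise`), the conclusion does not see the slots
  (`conclusion_with_fs_iff`); pins exist (`nonempty_tamePin`), the levels are finite (`finite_level`, H.0 + T1).

HONEST FRAMING: a REDUCTION — `thm161_dvrKolyvaginBound` is NOT proved here (its tame-pinned case is the refinement
programme's target: Thm. 1.4.2 / Prop. 1.4.1, Lemma 1.6.4 on the refined full tower); no summit statement is proved;
the Birch–Swinnerton-Dyer conjecture is not proved by any of this.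
References: [Howard2004HeegnerKolyvagin] B. Howard, Compositio Math. 140 (2004), Thm. 1.6.1, Prop. 1.1.7, Def. 1.1.8,
Def. 1.2.3, Thm. 1.7.5 (arXiv:1202.6340 Thm. 2.6.1 p. 11 L23–28; p. 5 L115–149; p. 6 L126 – p. 7 L12; p. 14 L30–44).
-/

set_option autoImplicit false

noncomputable section

open Function NumberField IsDedekindDomain Field
open scoped NumberField ContRepresentation Classical TensorProduct

namespace Literature.NumberTheory.GaloisCohomology.Howard2004

open Literature.NumberTheory.GaloisRepresentations
open Literature.NumberTheory.GaloisRepresentations.DiscreteGaloisModule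
open Literature.NumberTheory.GaloisRepresentations.galoisCohomology

section DVR

variable {p : ℕ} [Fact p.Prime] {K : Type} [Field K] [NumberField K]
  {R : Type} [CommRing R] [IsDomain R] [IsDiscreteValuationRing R] [Algebra ℤ_[p] R]
  {N : ℕ → Type} [∀ k, AddCommGroup (N k)] [∀ k, TopologicalSpace (N k)]
  [∀ k, DiscreteTopology (N k)] [∀ k, Module R (N k)]
  {Rk : ℕ → Type} [∀ k, CommRing (Rk k)] [∀ k, IsLocalRing (Rk k)] [∀ k, TopologicalSpace (Rk k)]
  [∀ k, DiscreteTopology (Rk k)] [∀ k, Algebra ℤ_[p] (Rk k)] [∀ k, Algebra R (Rk k)]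
  [∀ k, Module (Rk k) (N k)] [∀ k, IsScalarTower R (Rk k) (N k)]
  {Nbar : Type} [AddCommGroup Nbar] [TopologicalSpace Nbar] [DiscreteTopology Nbar]
  [∀ k, Module (Rk k) Nbar]
  {Nq : ℕ → Finset (HeightOneSpectrum (𝓞 K)) → Type} [∀ k n, AddCommGroup (Nq k n)]
  [∀ k n, TopologicalSpace (Nq k n)] [∀ k n, DiscreteTopology (Nq k n)]
  [∀ k n, Module (Rk k) (Nq k n)] [∀ k n, Module R (Nq k n)]
  [∀ k n, IsScalarTower R (Rk k) (Nq k n)]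

namespace DVRSetting

/-! ## «WLOG tame»: Theorem 1.6.1 for tame-pinned settings implies Theorem 1.6.1 as typed -/

/-- **H.0–H.5 for «`S` with the tame slots»**: replacing the finite–singular slots of a `DVRSetting` satisfying
H.0–H.5 by the guarded tame slots (same presentations, same `fsQ`) keeps `SatisfiesH` — every clause but the three
slot clauses is untouched; `fs_admissible` / `fs_natural` are the tree's `fs_admissible_of_fs_eq_tameSlotOn_levels` /
`fs_natural_of_fs_eq_tameSlotOn`, `fsQ_spec` is unchanged.
[cite: Howard2004HeegnerKolyvagin, Def. 1.1.8 / Def. 1.2.3 and §1.6 (arXiv p. 5 L144–149, p. 7 L1–12, p. 11 L13–54)] -/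
theorem satisfiesH_withTameSlotOn [∀ k n, Finite (Nq k n)] (S : DVRSetting p K R N Rk Nbar Nq) (hy : S.SatisfiesH)
    (pins : ∀ v : HeightOneSpectrum (𝓞 K), TamePin v)
    (hP : ∀ k n v, n ∈ levels S.L ∧ v ∈ n → TameHyp (S.LD k).ρq n v) :
    ({ S with LD := fun k => (S.LD k).withTameSlotOn pins (fun n v => n ∈ levels S.L ∧ v ∈ n) (hP k) } :
      DVRSetting p K R N Rk Nbar Nq).SatisfiesH :=
  { coeffRing := hy.coeffRing
    p_odd := hy.p_odd
    imagQuad := hy.imagQuad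
    unif := hy.unif
    e_strictMono := hy.e_strictMono
    e_zero := hy.e_zero
    killed := hy.killed
    ker_red := hy.ker_red
    algebraMap_surjective := hy.algebraMap_surjective
    ker_algebraMap := hy.ker_algebraMap
    redR_comp := hy.redR_comp
    scalarLinear := hy.scalarLinear
    h0 := hy.h0
    Sigma_eq := hy.Sigma_eq
    cond_smul := hy.cond_smul
    cond_red := hy.cond_red
    L_subset := hy.L_subset
    L_disjoint := hy.L_disjoint
    primes_eq := hy.primes_eq
    h1 := hy.h1
    πbar_red := hy.πbar_red
    h2 := hy.h2
    h3 := hy.h3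
    h4 := hy.h4
    e_red := hy.e_red
    θ_eq := hy.θ_eq
    h5a := hy.h5a
    h5b := hy.h5b
    h5c := hy.h5c
    fsQ_spec := hy.fsQ_spec
    fs_natural := fun k n v x =>
      DVRSetting.fs_natural_of_fs_eq_tameSlotOn
        ({ S with LD := fun k => (S.LD k).withTameSlotOn pins (fun n v => n ∈ levels S.L ∧ v ∈ n) (hP k) } :
          DVRSetting p K R N Rk Nbar Nq) pins (fun n v => n ∈ levels S.L ∧ v ∈ n) hP (fun _ => rfl)
        hy.fsQ_spec k n v x
    fs_admissible := fun k =>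
      DVRSetting.fs_admissible_of_fs_eq_tameSlotOn_levels
        ({ S with LD := fun k => (S.LD k).withTameSlotOn pins (fun n v => n ∈ levels S.L ∧ v ∈ n) (hP k) } :
          DVRSetting p K R N Rk Nbar Nq) pins hy.primes_eq hP (fun _ => rfl) k }

/-- **«WLOG tame»: Howard's Theorem 1.6.1 for TAME-PINNED settings implies Theorem 1.6.1 AS TYPED**
(`thm161_dvrKolyvaginBound`, quantifying over every admissible finite–singular slot).  Given `S` with H.0–H.5 and a
Kolyvagin system `κ` for its (admissible) slots: pass to «`S` with the tame slots» (same `T`, `F`, `𝓛`, same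
conclusion — `conclusion_with_fs_iff`), whose H.0–H.5 is `satisfiesH_withTameSlotOn`; `κ` becomes a Kolyvagin
system for the tame slots with THE SAME bottom class after the levelwise unit rescaling
(`exists_levelwise_units` + `exists_kolyvaginSystem_smul_of_isRescaledFs_levelwise`, the original slots being
admissible and natural along the reductions by `SatisfiesH.fs_admissible` / `fs_natural`); reading note (v) of
`FiniteSingularNatural` in the kernel.  The hypothesis is the shape in which the π-adic refinement programme
(`DVRSetting.refine`, tame-pinned) proves Thm. 1.6.1.
[cite: Howard2004HeegnerKolyvagin, Thm. 1.6.1, Def. 1.1.8, Def. 1.2.3 (arXiv:1202.6340 Thm. 2.6.1 p. 11 L23–28; p. 5 L144–149; p. 7 L1–12); cf. Thm. 1.7.5 (p. 14 L30–44)] -/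
theorem thm161_of_forall_tame
    (h : ∀ (p : ℕ) [Fact p.Prime] (K : Type) [Field K] [NumberField K]
      (R : Type) [CommRing R] [IsDomain R] [IsDiscreteValuationRing R] [Algebra ℤ_[p] R]
      (N : ℕ → Type) [∀ k, AddCommGroup (N k)] [∀ k, TopologicalSpace (N k)]
      [∀ k, DiscreteTopology (N k)] [∀ k, Module R (N k)]
      (Rk : ℕ → Type) [∀ k, CommRing (Rk k)] [∀ k, IsLocalRing (Rk k)] [∀ k, TopologicalSpace (Rk k)]
      [∀ k, DiscreteTopology (Rk k)] [∀ k, Algebra ℤ_[p] (Rk k)] [∀ k, Algebra R (Rk k)]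
      [∀ k, Module (Rk k) (N k)] [∀ k, IsScalarTower R (Rk k) (N k)]
      (Nbar : Type) [AddCommGroup Nbar] [TopologicalSpace Nbar] [DiscreteTopology Nbar]
      [∀ k, Module (Rk k) Nbar]
      (Nq : ℕ → Finset (HeightOneSpectrum (𝓞 K)) → Type) [∀ k n, AddCommGroup (Nq k n)]
      [∀ k n, TopologicalSpace (Nq k n)] [∀ k n, DiscreteTopology (Nq k n)]
      [∀ k n, Module (Rk k) (Nq k n)] [∀ k n, Module R (Nq k n)]
      [∀ k n, IsScalarTower R (Rk k) (Nq k n)] [∀ k n, Finite (Nq k n)]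
      (S : DVRSetting p K R N Rk Nbar Nq) (κ : S.KolyvaginSystem) (hy : S.SatisfiesH)
      (pins : ∀ v : HeightOneSpectrum (𝓞 K), TamePin v)
      (hP : ∀ k n v, n ∈ levels S.L ∧ v ∈ n → TameHyp (S.LD k).ρq n v),
      (∀ k, (S.LD k).fs = tameSlotOn pins (S.LD k).ρq (fun n v => n ∈ levels S.L ∧ v ∈ n) (hP k)) →
      S.LargePrimes → κ.one ≠ 0 → S.Conclusion hy κ.one) :
    thm161_dvrKolyvaginBound := by
  intro p _ K _ _ R _ _ _ _ N _ _ _ _ Rk _ _ _ _ _ _ _ _ Nbar _ _ _ _ Nq _ _ _ _ _ _ S κ hy hL hone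
  haveI hfin : ∀ k n, Finite (Nq k n) := fun k n =>
    haveI := S.finite_level hy k
    Finite.of_surjective _ ((S.LD k).isQuotientBy n).surjective
  let pins : ∀ v : HeightOneSpectrum (𝓞 K), TamePin v := fun v => (nonempty_tamePin v).some
  have hP : ∀ k n v, n ∈ levels S.L ∧ v ∈ n → TameHyp (S.LD k).ρq n v := fun k =>
    tameHyp_of_mem_levels_of_h0 (hy.h0 k) (S.LD k) (hy.primes_eq k)
  -- «S with the tame slots»
  let St : DVRSetting p K R N Rk Nbar Nq :=
    { S with LD := fun k => (S.LD k).withTameSlotOn pins (fun n v => n ∈ levels S.L ∧ v ∈ n) (hP k) }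
  have hyt : St.SatisfiesH := S.satisfiesH_withTameSlotOn hy pins hP
  have htame : ∀ k, (St.LD k).fs = tameSlotOn pins (St.LD k).ρq (fun n v => n ∈ levels St.L ∧ v ∈ n) (hP k) :=
    fun _ => rfl
  -- the original slots as a second admissible family on `St`
  have h2adm : ∀ k, ({ St.LD k with fs := (S.LD k).fs } : LevelData (Rk k) (St.T.ρ k) (St.t k) (Nq k)).IsFsAdmissible :=
    fun k => hy.fs_admissible k
  obtain ⟨u, w, hwu, hrel, hcompat⟩ := St.exists_levelwise_units hyt pins hP htame (fun k => (S.LD k).fs) h2adm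
    hy.fs_natural
  obtain ⟨κt, hκone, -⟩ := St.exists_kolyvaginSystem_smul_of_isRescaledFs_levelwise hyt
    (fun k => hyt.isSelmerScalarStable k) (fun k n v _ hn => hyt.fsScalarNaturalAt k n v hn)
    (fun k => (S.LD k).fs) u w hwu hrel hcompat κ.κ κ.ks κ.κ_red κ.one κ.one_mem κ.κ_one
  have hconc : St.Conclusion hyt κt.one :=
    h p K R N Rk Nbar Nq St κt hyt pins hP htame hL (hκone ▸ hone)
  rw [hκone] at hconc
  exact (S.conclusion_with_fs_iff (fun k => tameSlotOn pins (S.LD k).ρq (fun n v => n ∈ levels S.L ∧ v ∈ n) (hP k))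
    hy hyt κ.one).1 hconc

end DVRSetting

end DVR

end Literature.NumberTheory.GaloisCohomology.Howard2004

end
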